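import Mathlib.Analysis.InnerProductSpace.PiL2
import Mathlib.LinearAlgebra.Matrix.Determinant.Basic
import Mathlib.LinearAlgebra.Matrix.RowCol
import HarnessLib

/-!
# The Gram-weighted minor bound is stable under replacing one row

The `n!`-free tree estimate for truncated fermionic expectations
(`FermionicTreeExpansionDetBound.norm_ursellOf_moment_le_sum_lineSets_of_detBound`) asks of the
propagator matrix `G : Matrix F F 𝕜` a DETERMINANT BOUND on all its Gram-weighted minors:

  `‖det (⟪w_{ρ a}, w_{γ b}⟫ · G_{e ρ a, e γ b})_{a,b < c'}‖ ≤ δ^{c'}`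

for unit vectors `w`, increasing enumerations `e` and strictly increasing selections `ρ, γ` (satisfied with
`δ = 2` by chronological free-fermion propagator matrices, `PropMatrixTruncatedBound`). Differentiating
a connected coefficient along a one-parameter family of propagators replaces, one at a time, a row of
`G` by the corresponding row of the derivative (`UrsellMomentRowLinear`). This file shows that the
determinant bound survives such a replacement: if `G` has the bound `δ ≥ 1` and the new row `r` has
`Σ_b ‖r b‖ ≤ M` with `δ ≤ M`, then `G.updateRow a₀ r` has the bound `M`
(**`weightedMinor_detBound_updateRow`**) — Laplace expansion along the replaced row (its weighted
entries are at most `‖r b‖` by Cauchy–Schwarz), the cofactors being weighted minors of `G`.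

* `norm_real_inner_le_one` — `|⟪u, v⟫| ≤ 1` for unit vectors;
* `sum_norm_comp_le_of_injective` — `Σ_j ‖r (φ j)‖ ≤ Σ_b ‖r b‖` for injective `φ`;
* **`weightedMinor_detBound_updateRow`** — the stability theorem.

Everything is PROVED; no definition and no named fact.

## References

* G. Benfatto, A. Giuliani, V. Mastropietro, Ann. Henri Poincaré 7 (2006) 809–898, (2.80) (the Gram
  bound fed into the tree expansion). [cite: BenfattoGiulianiMastropietro2006, (2.77) (2.80)]
* W. de Siqueira Pedra, M. Salmhofer, Comm. Math. Phys. 282 (2008) 797–818, Thm 2.4.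
  [cite: PedraSalmhofer2008, Thm 2.4]
-/

noncomputable section

open Finset Matrix

namespace Literature.MathematicalPhysics.QuantumLattice

variable {𝕜 : Type*} [RCLike 𝕜] {F : Type*} [LinearOrder F] [Fintype F]

/-- `|⟪u, v⟫| ≤ 1` for unit vectors. [folklore] -/
theorem norm_real_inner_le_one {m : ℕ} {u v : EuclideanSpace ℝ (Fin m)} (hu : ‖u‖ = 1) (hv : ‖v‖ = 1) :
    ‖((inner ℝ u v : ℝ) : 𝕜)‖ ≤ 1 := by
  rw [RCLike.norm_ofReal]
  have h := abs_real_inner_le_norm u v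
  rw [hu, hv, one_mul] at h
  exact h

omit [LinearOrder F] in
/-- Summing `‖r‖` along an injective map is at most the full sum. [folklore] -/
theorem sum_norm_comp_le_of_injective {n : ℕ} (r : F → 𝕜) {φ : Fin n → F} (hφ : Function.Injective φ) :
    ∑ j : Fin n, ‖r (φ j)‖ ≤ ∑ b : F, ‖r b‖ := by
  classical
  calc ∑ j : Fin n, ‖r (φ j)‖ = ∑ b ∈ (univ : Finset (Fin n)).image φ, ‖r b‖ := by
        rw [Finset.sum_image fun j _ j' _ h => hφ h]
    _ ≤ ∑ b : F, ‖r b‖ :=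
        Finset.sum_le_univ_sum_of_nonneg fun b => norm_nonneg _

/-- **The Gram-weighted minor bound is stable under replacing one row.** If every Gram-weighted minor of
`G` of size `c'` has norm `≤ δ^{c'}` (`δ ≥ 1`) and `Σ_b ‖r b‖ ≤ M` with `δ ≤ M`, then every Gram-weighted
minor of `G.updateRow a₀ r` of size `c'` has norm `≤ M^{c'}`. [cite: BenfattoGiulianiMastropietro2006, (2.77) (2.80)] -/
theorem weightedMinor_detBound_updateRow (G : Matrix F F 𝕜) {δ : ℝ} (hδ : 1 ≤ δ)
    (hDB : ∀ (m r : ℕ) (w : Fin r → EuclideanSpace ℝ (Fin m)), (∀ a, ‖w a‖ = 1) →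
      ∀ (e : Fin r ↪o F) (c' : ℕ) (ρ γ : Fin c' → Fin r), StrictMono ρ → StrictMono γ →
        ‖(Matrix.of fun a b : Fin c' =>
            ((inner ℝ (w (ρ a)) (w (γ b)) : ℝ) : 𝕜) * G (e (ρ a)) (e (γ b))).det‖ ≤ δ ^ c')
    (a₀ : F) (r : F → 𝕜) {M : ℝ} (hM : δ ≤ M) (hr : ∑ b, ‖r b‖ ≤ M) :
    ∀ (m n : ℕ) (w : Fin n → EuclideanSpace ℝ (Fin m)), (∀ a, ‖w a‖ = 1) →
      ∀ (e : Fin n ↪o F) (c' : ℕ) (ρ γ : Fin c' → Fin n), StrictMono ρ → StrictMono γ →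
        ‖(Matrix.of fun a b : Fin c' =>
            ((inner ℝ (w (ρ a)) (w (γ b)) : ℝ) : 𝕜) * (G.updateRow a₀ r) (e (ρ a)) (e (γ b))).det‖ ≤ M ^ c' := by
  intro m n w hw e c' ρ γ hρ hγ
  have hM1 : 1 ≤ M := hδ.trans hM
  have hM0 : 0 ≤ M := zero_le_one.trans hM1
  have hδ0 : 0 ≤ δ := zero_le_one.trans hδ
  by_cases hrow : ∃ i : Fin c', e (ρ i) = a₀
  · -- the replaced row is selected: Laplace along it
    obtain ⟨i, hi⟩ := hrow
    obtain ⟨n', rfl⟩ : ∃ n', c' = n' + 1 := ⟨c' - 1, by have := i.isLt; omega⟩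
    set A : Matrix (Fin (n' + 1)) (Fin (n' + 1)) 𝕜 := Matrix.of fun a b : Fin (n' + 1) =>
      ((inner ℝ (w (ρ a)) (w (γ b)) : ℝ) : 𝕜) * (G.updateRow a₀ r) (e (ρ a)) (e (γ b)) with hA
    -- the other selected rows are rows of `G`
    have hother : ∀ a : Fin (n' + 1), a ≠ i → (G.updateRow a₀ r) (e (ρ a)) = G (e (ρ a)) := by
      intro a ha
      rw [Matrix.updateRow_ne]
      intro h
      exact ha (hρ.injective (e.injective (h.trans hi.symm)))
    -- the cofactors are weighted minors of `G`
    have hminor : ∀ j : Fin (n' + 1),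
        ‖(A.submatrix i.succAbove j.succAbove).det‖ ≤ δ ^ n' := by
      intro j
      have heq : A.submatrix i.succAbove j.succAbove = Matrix.of fun a b : Fin n' =>
          ((inner ℝ (w ((ρ ∘ i.succAbove) a)) (w ((γ ∘ j.succAbove) b)) : ℝ) : 𝕜) *
            G (e ((ρ ∘ i.succAbove) a)) (e ((γ ∘ j.succAbove) b)) := by
        ext a b
        simp only [hA, Matrix.submatrix_apply, Matrix.of_apply, Function.comp_apply]
        rw [hother _ (Fin.succAbove_ne i a)]
      rw [heq]
      exact hDB m n w hw e n' (ρ ∘ i.succAbove) (γ ∘ j.succAbove)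
        (hρ.comp (Fin.strictMono_succAbove i)) (hγ.comp (Fin.strictMono_succAbove j))
    -- the entries of the replaced row
    have hentry : ∀ j : Fin (n' + 1), ‖A i j‖ ≤ ‖r (e (γ j))‖ := by
      intro j
      simp only [hA, Matrix.of_apply, hi, Matrix.updateRow_self]
      rw [norm_mul]
      exact (mul_le_mul_of_nonneg_right (norm_real_inner_le_one (hw _) (hw _)) (norm_nonneg _)).trans
        (by rw [one_mul])
    rw [Matrix.det_succ_row A i]
    calc ‖∑ j : Fin (n' + 1), (-1) ^ (i + j : ℕ) * A i j * (A.submatrix i.succAbove j.succAbove).det‖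
        ≤ ∑ j : Fin (n' + 1), ‖(-1) ^ (i + j : ℕ) * A i j * (A.submatrix i.succAbove j.succAbove).det‖ :=
          norm_sum_le _ _
      _ ≤ ∑ j : Fin (n' + 1), ‖r (e (γ j))‖ * δ ^ n' := by
          refine sum_le_sum fun j _ => ?_
          rw [norm_mul, norm_mul, norm_pow, norm_neg, norm_one, one_pow, one_mul]
          exact mul_le_mul (hentry j) (hminor j) (norm_nonneg _) (norm_nonneg _)
      _ = (∑ j : Fin (n' + 1), ‖r (e (γ j))‖) * δ ^ n' := by rw [Finset.sum_mul]
      _ ≤ M * δ ^ n' := by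
          refine mul_le_mul_of_nonneg_right ?_ (pow_nonneg hδ0 _)
          exact (sum_norm_comp_le_of_injective r (e.injective.comp hγ.injective)).trans hr
      _ ≤ M * M ^ n' := mul_le_mul_of_nonneg_left (pow_le_pow_left₀ hδ0 hM n') hM0
      _ = M ^ (n' + 1) := by rw [pow_succ]; ring
  · -- the replaced row is not selected: a weighted minor of `G`
    push Not at hrow
    have heq : (Matrix.of fun a b : Fin c' =>
        ((inner ℝ (w (ρ a)) (w (γ b)) : ℝ) : 𝕜) * (G.updateRow a₀ r) (e (ρ a)) (e (γ b))) =
        Matrix.of fun a b : Fin c' => ((inner ℝ (w (ρ a)) (w (γ b)) : ℝ) : 𝕜) * G (e (ρ a)) (e (γ b)) := by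
      ext a b
      simp only [Matrix.of_apply]
      rw [Matrix.updateRow_ne (hrow a)]
    rw [heq]
    exact (hDB m n w hw e c' ρ γ hρ hγ).trans (pow_le_pow_left₀ hδ0 hM c')

end Literature.MathematicalPhysics.QuantumLattice
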